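import Summits.BirchSwinnertonDyer.BirchSwinnertonDyer.Theorems.ByReductionTypeAtTwoAdditiveKatoTransportPrintExact
import Literature.NumberTheory.EllipticCurves.Kato2004.IwasawaInvolutionTwistSelmerProofs
import HarnessLib

/-!
# Route ByReductionTypeAtTwo, crux `AdditiveRankZeroAtTwo` (stmt-BirchSwinnertonDyer-19098) — the PRINT-EXACT typed input
# SUFFICES for the key-`γ` conclusion: `ℓ_𝔮(X(W/ℚ_∞)) ≤ ℓ_𝔮(Λ/(L̃))` at EVERY height-one `𝔮 ∌ 2` for the tree's key-`γ` dual
# Selmer datum, from `KatoOddBranchInputsAtTwoNegOneSplitTwistPrintExact` (key `γ⁻¹`) by the `ι`-twist of dual Selmer data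
# (`Kato2004.selmerDualData_exists_involTwist`, ticket T-TWIST-SEL-1) and the functional equation (theorems only)

Seat `bsd-2adic-addL2x` GEN 16 (sequel of `…PrintExact.lean` p683821; pen RC-364 (1) AP4). With this file the cell may price the
(−1)-block with the PRINT-EXACT input (the species of `Kato2004.exists_multDivisibilityInputs_split_contra` at `2`) in place of
the key-`γ` input `KatoOddBranchInputsAtTwoNegOneSplitTwist` (the species of K11b, «stronger than print by ι as a package»):
the END statement for the key-`γ` datum follows from the key-`γ⁻¹` door `lengthAt_selmerDualContra_le_of_oddBranchInputsPrintExact`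
applied at `ι𝔮`, the transport of lengths `ℓ_𝔮(D.X) = ℓ_{ι𝔮}(D'.X)` (`Kato2004.selmerDualData_lengthAt_eq_inv`), of finite
generation and of Greenberg's symmetry between the keys (`…_finite_inv`, `…_map_invol_charIdeal_iff_inv`), and the symmetry
`ℓ_𝔮(Λ/(L̃)) = ℓ_{ι𝔮}(Λ/(L̃))` (functional equation, `Kato2004.lengthAt_quotient_span_eq_comap_invol_of_map_invol_span_eq`).
HONEST FRAMING (cell `bsd-2adic`, D-0036/D-0054): theorems CONDITIONAL on named inputs; types-the-object-of; closes none; nothing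
booked; BSD is not proved by any of this.

References: [Kato2004Asterisque] Thm. 12.4 (2), 12.5 (3) with (12.5.1), §17.3, §17.13; [Greenberg1989] pp. 101–102 (`S^ι`);
[GreenbergLNM1716] Thm. 1.14, §1 p. 60; [MazurTateTeitelbaum1986Invent] §I.17.
-/

set_option autoImplicit false
-- the summit's namespace `Summit.BirchSwinnertonDyer.BirchSwinnertonDyer` (Sub = Summit) trips `dupNamespace`
set_option linter.dupNamespace false

noncomputable section

open scoped Classical MatrixGroups ModularForm

open Field CongruenceSubgroup WeierstrassCurve Literature.NumberTheory.EllipticCurves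
  Literature.NumberTheory.EllipticCurves.ModularForms Literature.NumberTheory.EllipticCurves.IwasawaAlgebra
  Literature.NumberTheory.EllipticCurves.Module

namespace Summit.BirchSwinnertonDyer.BirchSwinnertonDyer.Theorems.AddKatoTwo

/-- **Kato's divisibility `ℓ_𝔮(X(W/ℚ_∞)) ≤ ℓ_𝔮(Λ/(L̃))` at EVERY height-one `𝔮 ∌ 2` for the KEY-`γ` dual Selmer datum of `W`
(additive at `2`, `W^{(−1)}` split multiplicative, `W[2]` irreducible), from the PRINT-EXACT typed input**
`KatoOddBranchInputsAtTwoNegOneSplitTwistPrintExact` (key `γ⁻¹`), `Kato2004.thm12_4`, `ι(char D.X) = char D.X` (Greenberg 1.14 ×2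
+ twist decomposition, T20 (a); transported to the key-`γ⁻¹` twist by `Kato2004.selmerDualData_map_invol_charIdeal_iff_inv`)
and `(ι L̃) = (L̃)` (T20 (d)). Proof: twist `D` to a key-`γ⁻¹` datum `D'` (`Kato2004.selmerDualData_exists_involTwist`), apply the
key-`γ⁻¹` door at `ι𝔮`, and transport back (`ℓ_𝔮(D.X) = ℓ_{ι𝔮}(D'.X)`, functional equation).
[cite: Kato2004Asterisque, Thm. 12.4 (2) (p. 221), Thm. 12.5 (3) and (12.5.1) (p. 222), §17.3 (p. 273), §17.13 (pp. 279–280)]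
[cite: Greenberg1989, pp. 101–102 (S^ι)] [cite: GreenbergLNM1716, Thm. 1.14 (p. 68)] [cite: MazurTateTeitelbaum1986Invent, §I.17] -/
theorem lengthAt_selmerDual_le_of_oddBranchInputsPrintExact (h12 : Kato2004.thm12_4)
    (hPE : KatoOddBranchInputsAtTwoNegOneSplitTwistPrintExact)
    (W : WeierstrassCurve ℚ) [W.IsElliptic] [W.IsGloballyMinimal] [ContinuousSMul ℤ_[2] (W.tateModule 2)]
    {N : ℕ} [NeZero N] (f : CuspForm (Gamma0 N) 2) (κ : ZpExtension ℚ 2) (γ : absoluteGaloisGroup ℚ)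
    (hsp : (W.quadraticTwist (-1)).HasSplitMultiplicativeReductionAtPrime 2)
    (hirr : W.HasIrreducibleModPGaloisRep 2) (hκ : κ.IsCyclotomic) (hγ : κ.IsTopGenerator γ)
    (hγ' : IsCyclotomicVariable 2 γ) (hf : IsNewformOf (W.quadraticTwist (-1)) f)
    (I : Kato2004.IwasawaH1Data W 2 κ γ) (D : W.SelmerDualData κ γ) [Module.Finite (IwasawaAlgebra 2) D.X]
    (hXι : (charIdeal (IwasawaAlgebra 2) D.X).map (invol 2).toRingHom = charIdeal (IwasawaAlgebra 2) D.X)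
    (Lt : IwasawaAlgebra 2) (m : ℕ)
    (hLt : iwasawaToPowerSeries 2 Lt =
      PowerSeries.C ((2 : ℚ_[2]) ^ m) * padicLFunctionMinusBranchMult f (1 : ℚ_[2]) 1)
    (hLt0 : Lt ≠ 0) (hLtι : (Ideal.span {Lt}).map (invol 2).toRingHom = Ideal.span {Lt})
    (𝔮 : PrimeSpectrum (IwasawaAlgebra 2)) (h𝔮 : 𝔮.asIdeal.height = 1)
    (hp𝔮 : PowerSeries.C (2 : ℤ_[2]) ∉ 𝔮.asIdeal) :
    lengthAt (IwasawaAlgebra 2) D.X 𝔮 ≤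
      lengthAt (IwasawaAlgebra 2) (IwasawaAlgebra 2 ⧸ Ideal.span {Lt}) 𝔮 := by
  haveI : Fact (Nat.Prime 2) := ⟨Nat.prime_two⟩
  -- the key-`γ⁻¹` twist of `D`
  obtain ⟨D', e, he, -⟩ := Kato2004.selmerDualData_exists_involTwist (mul_inv_cancel γ) D
  haveI : Module.Finite (IwasawaAlgebra 2) D'.X := Kato2004.selmerDualData_finite_inv D D'
  have hX'ι : (charIdeal (IwasawaAlgebra 2) D'.X).map (invol 2).toRingHom = charIdeal (IwasawaAlgebra 2) D'.X :=
    (Kato2004.selmerDualData_map_invol_charIdeal_iff_inv D D').mp hXι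
  -- the conjugate prime
  set 𝔮' := PrimeSpectrum.comap (invol 2).toRingHom 𝔮 with h𝔮'def
  have h𝔮' : 𝔮'.asIdeal.height = 1 := by rw [h𝔮'def, Kato2004.height_comap_invol]; exact h𝔮
  have hp𝔮' : PowerSeries.C (2 : ℤ_[2]) ∉ 𝔮'.asIdeal := by
    intro h
    apply hp𝔮
    rw [h𝔮'def, PrimeSpectrum.comap_asIdeal, Ideal.mem_comap] at h
    change invol 2 (PowerSeries.C (2 : ℤ_[2])) ∈ 𝔮.asIdeal at h
    rwa [invol_C] at h
  -- the key-`γ⁻¹` door at `ι𝔮`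
  have hA := lengthAt_selmerDualContra_le_of_oddBranchInputsPrintExact h12 hPE W f κ γ hsp hirr hκ hγ hγ' hf I D' hX'ι
    Lt m hLt hLt0 hLtι 𝔮' h𝔮' hp𝔮'
  -- transport back to key `γ` at `𝔮`
  rw [Kato2004.selmerDualData_lengthAt_eq_inv D D' 𝔮,
    Kato2004.lengthAt_quotient_span_eq_comap_invol_of_map_invol_span_eq hLtι 𝔮]
  exact hA

end Summit.BirchSwinnertonDyer.BirchSwinnertonDyer.Theorems.AddKatoTwo

end
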